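/-
Copyright (c) 2026 the pub-hodgecm-mathlib formalisation cell (harness21).  Prover seat hodgecm-mathlib-K2E1-p10 (g2), Track B ∕ K2-LIT (build stream 29), h413 = `stmt-HodgeConjecture-24833`,
route of record `HCCMUnconditional`, ROADCARD «5Res ENDGAME BY FAMILIES» §2 C7, dealer K2E1-plan (g7) deal F3d-ε — FILE ε2: AT A FIXED OPEN LEVEL ONLY FINITELY MANY HECKE CHARACTERS
TRIVIAL ON THE REAL RAY OCCUR.
-/
import Summits.HodgeConjecture.HodgeConjecture.Theorems.K2E1NormOneIdeleClassRetractionU   -- ★ α-0 (K2E1-p12): `compactSpace_normOne` (`C_E¹` compact)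
import Literature.NumberTheory.Automorphic.IdeleClassGroupProofs                         -- ★ `normOne_sup_posReal_eq_top_holds` (`C_E = C_E¹ · ℝ_{>0}`)
import Mathlib.RingTheory.RootsOfUnity.Basic
import Mathlib.Topology.Algebra.OpenSubgroup
import HarnessLib

/-!
# h413 ∕ Track B «K2-LIT», ROADCARD «5Res BY FAMILIES» C7, FILE F3d-ε2 — helper `K2E1HeckeCharacterLevelFinitenessU`: for an OPEN subgroup `U ≤ 𝕀_E`, the set of Hecke characters of `E`
# trivial on `U` and on the positive real ray `r_∞(ℝ_{>0})` is FINITE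

Cell `pub/hodgecm-mathlib`, crux h413 = `stmt-HodgeConjecture-24833`, route of record `HCCMUnconditional`; dealer K2E1-plan (g7) (F3d-ε «=» 13:13Z).  THEOREMS ONLY (no `def`, no `instance`, no
notation, no named-fact hypothesis, no `sorry`); lane `--supports stmt-HodgeConjecture-24833 --as helper` (count-neutral).  Closes no socket.  Any number field `E`.

THE MATHEMATICS ([WeilBNT1967, Ch. IV §4 Thm. 6–7]; [NeukirchANT1999, VI (1.6), VII (6.1)]).  A Hecke character `χ` descends to `χ̄ : C_E = 𝕀_E⧸E^× → ℂˣ`.  If `χ` is trivial on the ray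
then `χ` is determined by `χ̄|_{C_E¹}` (`C_E = C_E¹ · ℝ_{>0}`, ★ `normOne_sup_posReal_eq_top_holds`); if moreover `χ(U) = 1` then `χ̄|_{C_E¹}` factors through the quotient of the COMPACT
group `C_E¹` (★ `compactSpace_normOne`) by the OPEN subgroup `(U E^×⧸E^×) ∩ C_E¹`, a FINITE group `Q` (Mathlib `Subgroup.quotient_finite_of_isOpen`), with values in the `|Q|`-th roots of
unity; so `χ ↦ (q ↦ χ̄(q̃))` injects our set into the finite type `Q → μ_{|Q|}(ℂ)`.

* §1 `lift_coe` (the descent `χ̄`), `eq_of_forall_mem_normOne` (ray-trivial characters are determined on `C_E¹`).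
* §2 **`finite_setOf_heckeCharacter_trivial_on`**.

HONEST LABEL: HC_CM is proved only modulo the 7 printed citations (2 remaining named inputs: hLiu418 = `stmt-HodgeConjecture-24832`, h413 = `stmt-HodgeConjecture-24833`) until rung 0
closes; this file asserts no named fact and closes no socket.
References: [WeilBNT1967] A. Weil, *Basic Number Theory*, Ch. IV §4 Thm. 6–7; [NeukirchANT1999] J. Neukirch, *Algebraic Number Theory*, Ch. VI (1.6), Ch. VII (6.1).
-/

set_option autoImplicit false
set_option linter.dupNamespace false  -- the mandated namespace repeats the summit's segment (`HodgeConjecture.HodgeConjecture`)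

noncomputable section

open Set Topology NumberField
open Literature.NumberTheory.Automorphic Literature.NumberTheory.GaloisRepresentations
open Summit.HodgeConjecture.HodgeConjecture.Cruxes.H413.K2E1NormOneIdeleClassRetractionU (compactSpace_normOne)
open scoped NNReal

namespace Summit.HodgeConjecture.HodgeConjecture.Cruxes.H413.K2E1HeckeCharacterLevelFinitenessU

variable (E : Type) [Field E] [NumberField E]

/-! ## §1 The descent to `C_E` and determination on `C_E¹` -/

/-- `E^× ≤ ker χ`: a Hecke character kills the principal ideles (the hypothesis of Mathlib `QuotientGroup.lift`). [cite: NeukirchANT1999, VII (6.1)] -/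
theorem principalIdeles_le_ker (χ : HeckeCharacter E) : principalIdeles E ≤ (χ.toContinuousMonoidHom.toMonoidHom).ker := fun _ hy => by
  rw [MonoidHom.mem_ker]; exact χ.map_principal hy

/-- The descent `χ̄ : C_E →* ℂˣ` of a Hecke character evaluates as `χ` on classes (Mathlib `QuotientGroup.lift_mk`). [cite: NeukirchANT1999, VII (6.1)] -/
theorem lift_coe (χ : HeckeCharacter E) (x : ideleGroup E) :
    QuotientGroup.lift (principalIdeles E) χ.toContinuousMonoidHom.toMonoidHom (principalIdeles_le_ker E χ) (x : IdeleClassGroup E) = χ x := by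
  rw [QuotientGroup.lift_mk]; rfl

/-- **A RAY-TRIVIAL HECKE CHARACTER IS DETERMINED BY ITS VALUES ON NORM-ONE CLASSES**: `x = x₁ · r_∞(‖x‖^{1∕[E:ℚ]})` with `‖x₁‖ = 1` (the `[E:ℚ]`-th root of ★ α-0
`exists_rootHom`, ★ `ideleNorm_posRealIdele_holds`). [cite: WeilBNT1967, Ch. IV §4 Cor. 2 of Thm. 6] -/
theorem eq_of_forall_mem_normOne {χ₁ χ₂ : HeckeCharacter E} (h₁ : ∀ r : ℝ≥0ˣ, χ₁ (posRealIdele E r) = 1) (h₂ : ∀ r : ℝ≥0ˣ, χ₂ (posRealIdele E r) = 1)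
    (h : ∀ c : IdeleClassGroup E, c ∈ IdeleClassGroup.normOne E →
      QuotientGroup.lift (principalIdeles E) χ₁.toContinuousMonoidHom.toMonoidHom (principalIdeles_le_ker E χ₁) c =
        QuotientGroup.lift (principalIdeles E) χ₂.toContinuousMonoidHom.toMonoidHom (principalIdeles_le_ker E χ₂) c) :
    χ₁ = χ₂ := by
  ext x
  have hd0 : Module.finrank ℚ E ≠ 0 := Module.finrank_pos.ne'
  obtain ⟨φ, -, hφd, -⟩ := Summit.HodgeConjecture.HodgeConjecture.Cruxes.H413.K2E1NormOneIdeleClassRetractionU.exists_rootHom hd0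
  -- `x = x₁ · r_∞(r)`, `r = ‖x‖^{1/d}`, `‖x₁‖ = 1`
  set nx : ℝ≥0ˣ := Units.mk0 (IdeleClassGroup.ideleNorm E x) (ideleNorm_ne_zero x) with hnx
  set r : ℝ≥0ˣ := φ nx with hr
  set x₁ : ideleGroup E := x * (posRealIdele E r)⁻¹ with hx₁
  have hN₁ : IdeleClassGroup.ideleNorm E x₁ = 1 := by
    rw [hx₁, map_mul, map_inv, ideleNorm_posRealIdele_holds E r, hr, hφd nx, hnx, Units.val_mk0,
      mul_inv_cancel₀ (ideleNorm_ne_zero x)]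
  have hc : (x₁ : IdeleClassGroup E) ∈ IdeleClassGroup.normOne E := by
    rw [IdeleClassGroup.mem_normOne_iff, IdeleClassGroup.norm_mk]; exact hN₁
  have hxeq : x = x₁ * posRealIdele E r := by rw [hx₁, inv_mul_cancel_right]
  have key : ∀ (χ : HeckeCharacter E), (∀ r : ℝ≥0ˣ, χ (posRealIdele E r) = 1) →
      χ x = QuotientGroup.lift (principalIdeles E) χ.toContinuousMonoidHom.toMonoidHom (principalIdeles_le_ker E χ) (x₁ : IdeleClassGroup E) := fun χ hχ => by
    rw [lift_coe, hxeq, map_mul, hχ r, mul_one]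
  rw [key χ₁ h₁, key χ₂ h₂, h _ hc]

/-! ## §2 Finiteness at an open level -/

/-- **FINITELY MANY RAY-TRIVIAL HECKE CHARACTERS AT AN OPEN LEVEL**: for an open subgroup `U ≤ 𝕀_E`, `{χ | χ(r_∞(ℝ_{>0})) = 1 ∧ χ(U) = 1}` is finite (they factor through the finite group
`C_E¹ ⧸ ((U E^×⧸E^×) ∩ C_E¹)` with values in roots of unity). [cite: WeilBNT1967, Ch. IV §4 Thm. 7] [cite: NeukirchANT1999, VI (1.6)] -/
theorem finite_setOf_heckeCharacter_trivial_on (U : Subgroup (ideleGroup E)) (hU : IsOpen (U : Set (ideleGroup E))) :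
    {χ : HeckeCharacter E | (∀ r : ℝ≥0ˣ, χ (posRealIdele E r) = 1) ∧ ∀ u ∈ U, χ u = 1}.Finite := by
  classical
  haveI := compactSpace_normOne E
  -- the open subgroup `U₁ = (U E^×⧸E^×) ∩ C_E¹` of the compact group `C_E¹` and the finite quotient
  set U₁ : Subgroup ↥(IdeleClassGroup.normOne E) := (U.map (QuotientGroup.mk' (principalIdeles E))).subgroupOf (IdeleClassGroup.normOne E) with hU₁
  haveI hUn : U₁.Normal := inferInstance
  have hU₁o : IsOpen (U₁ : Set ↥(IdeleClassGroup.normOne E)) := by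
    have h1 : IsOpen ((U.map (QuotientGroup.mk' (principalIdeles E)) : Subgroup (IdeleClassGroup E)) : Set (IdeleClassGroup E)) := by
      rw [Subgroup.coe_map]; exact QuotientGroup.isOpenMap_coe _ hU
    exact h1.preimage continuous_subtype_val
  haveI hfin : Finite (↥(IdeleClassGroup.normOne E) ⧸ U₁) := Subgroup.quotient_finite_of_isOpen U₁ hU₁o
  set n : ℕ := Nat.card (↥(IdeleClassGroup.normOne E) ⧸ U₁) with hn
  haveI : NeZero n := ⟨Nat.card_pos.ne'⟩
  -- the descent kills `U₁`
  have hkill : ∀ (χ : HeckeCharacter E), (∀ u ∈ U, χ u = 1) → ∀ u₁ : ↥(IdeleClassGroup.normOne E), u₁ ∈ U₁ →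
      QuotientGroup.lift (principalIdeles E) χ.toContinuousMonoidHom.toMonoidHom (principalIdeles_le_ker E χ) (u₁ : IdeleClassGroup E) = 1 := by
    intro χ hχ u₁ hu₁
    obtain ⟨u, hu, hu'⟩ := Subgroup.mem_map.1 (Subgroup.mem_subgroupOf.1 hu₁)
    rw [← hu']
    exact hχ u hu
  -- every class of `C_E¹` is `q.out · u₁`
  have hrep : ∀ c : ↥(IdeleClassGroup.normOne E), ∃ u₁ ∈ U₁, c = (QuotientGroup.mk c : ↥(IdeleClassGroup.normOne E) ⧸ U₁).out * u₁ := fun c => by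
    obtain ⟨u₁, hu₁⟩ := QuotientGroup.mk_out_eq_mul U₁ c
    exact ⟨u₁⁻¹, U₁.inv_mem u₁.2, by rw [hu₁]; simp⟩
  -- the values on `C_E¹` are `n`-th roots of unity
  have hroot : ∀ (χ : HeckeCharacter E), (∀ u ∈ U, χ u = 1) → ∀ c : ↥(IdeleClassGroup.normOne E),
      (QuotientGroup.lift (principalIdeles E) χ.toContinuousMonoidHom.toMonoidHom (principalIdeles_le_ker E χ) (c : IdeleClassGroup E)) ^ n = 1 := by
    intro χ hχ c
    have h1 : (QuotientGroup.mk c : ↥(IdeleClassGroup.normOne E) ⧸ U₁) ^ n = 1 := pow_card_eq_one'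
    rw [← QuotientGroup.mk_pow, QuotientGroup.eq_one_iff] at h1
    have h2 := hkill χ hχ _ h1
    rw [Subgroup.coe_pow, map_pow] at h2
    exact h2
  -- the injection into the finite type `Q → μ_n(ℂ)`
  set S := {χ : HeckeCharacter E | (∀ r : ℝ≥0ˣ, χ (posRealIdele E r) = 1) ∧ ∀ u ∈ U, χ u = 1} with hS
  let Φ : ↥S → (↥(IdeleClassGroup.normOne E) ⧸ U₁ → rootsOfUnity n ℂ) := fun χ q =>
    ⟨QuotientGroup.lift (principalIdeles E) (χ : HeckeCharacter E).toContinuousMonoidHom.toMonoidHom (principalIdeles_le_ker E (χ : HeckeCharacter E)) ((q.out : ↥(IdeleClassGroup.normOne E)) : IdeleClassGroup E),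
      (mem_rootsOfUnity n _).2 (hroot χ χ.2.2 q.out)⟩
  have hΦv : ∀ (χ : ↥S) (q : ↥(IdeleClassGroup.normOne E) ⧸ U₁), ((Φ χ q : rootsOfUnity n ℂ) : ℂˣ) =
      QuotientGroup.lift (principalIdeles E) (χ : HeckeCharacter E).toContinuousMonoidHom.toMonoidHom (principalIdeles_le_ker E (χ : HeckeCharacter E)) ((q.out : ↥(IdeleClassGroup.normOne E)) : IdeleClassGroup E) :=
    fun χ q => rfl
  have hΦ : Function.Injective Φ := by
    rintro ⟨χ₁, hχ₁⟩ ⟨χ₂, hχ₂⟩ hEq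
    apply Subtype.ext
    refine eq_of_forall_mem_normOne E hχ₁.1 hχ₂.1 fun c hc => ?_
    obtain ⟨u₁, hu₁, hcu⟩ := hrep ⟨c, hc⟩
    have hq := congrArg (fun z : rootsOfUnity n ℂ => ((z : ℂˣ))) (congr_fun hEq (QuotientGroup.mk (⟨c, hc⟩ : ↥(IdeleClassGroup.normOne E))))
    simp only [hΦv] at hq
    have hc' : (c : IdeleClassGroup E) = (((QuotientGroup.mk (⟨c, hc⟩ : ↥(IdeleClassGroup.normOne E)) : ↥(IdeleClassGroup.normOne E) ⧸ U₁).out : ↥(IdeleClassGroup.normOne E)) : IdeleClassGroup E) *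
        (u₁ : IdeleClassGroup E) := by
      have h := congrArg (fun z : ↥(IdeleClassGroup.normOne E) => (z : IdeleClassGroup E)) hcu
      simpa only [Subgroup.coe_mul] using h
    rw [hc', map_mul, map_mul, hkill χ₁ hχ₁.2 u₁ hu₁, hkill χ₂ hχ₂.2 u₁ hu₁, hq]
  haveI : Finite ↥S := Finite.of_injective Φ hΦ
  exact S.toFinite

end Summit.HodgeConjecture.HodgeConjecture.Cruxes.H413.K2E1HeckeCharacterLevelFinitenessU

end
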